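import Summits.QuantumFields.BalabanUV.Beta.GAN24.ArrowOuterShiftBlocks
import Summits.QuantumFields.BalabanUV.Beta.GAN24.ArrowOuterShiftWeights
import Summits.QuantumFields.BalabanUV.Beta.GAN24.ArrowScaling
import Summits.QuantumFields.BalabanUV.Beta.GAN24.AliasFibreBridge

/-!
# `BalabanUV.Beta.GAN24.ArrowOuterShiftBorders` — (PART 4a: radii + the border half of) binder row G-an2-4 / (CONV-C), road P1-fibre, p1 row **P1-L10** `FibreStrip` ((I3′), the strip half of the K-slot),
# leaf-16's cut (M4) `L10-CUT-M4.md` row **F6 = THE OUTER LIPSCHITZ BOUND** of the scaled arrow operator (SKELETON-P1 A5 v0.3, p1's L10(i) made quantitative):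
# `‖F̃_N^{out,q}(p) − F̃_N^{out,q}(q)‖ ≤ cOut(D)·η·(1 + 1/|q|₂)³` for `Re p = q ∈ BZ ∖ {0}`, `|Im p| ≤ η ≤ 1`, UNIFORMLY IN `N ≥ 1`

NOT IN PRINT; OUR PROOF ATTEMPT.  HONEST FRAMING (cell contract, verbatim): «discharging `BetaPertH` makes Bałaban's UV stability UNCONDITIONAL — a real
constructive-QFT result; it is NOT the continuum limit and NOT the Clay problem.»  HONEST DEPENDENCY (verbatim): «continuum YM on T⁴ ⇐ BetaPertH ∧ nine spine
estimates (0/9 proved); BetaPertH ⇐ (D1) ∧ (D4) ∧ CAP+tail; G-an2-4 gates asym, D1 and NE2/3/4.»  [folklore] norm bookkeeping BY NAME over leaf-16's F1 currency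
(`ArrowOperator.arrowMat/arrowMat_sub/tBlock`, `ArrowNorms.norm_arrow_le/norm_colBorder_le/norm_rowBorder_le`, `ArrowScaling.outerArrow/scaledArrow_T/_wE/_wG/_wM/_wQ/
radO/sq_radO/radO_pos/arrowMat_eq_norms`), leaf-06's bridge `AliasFibreBridge` (`chiHat = chiAl`, `sflat = sbAl`, `boxS = SAl`, `boxSs = SAl·sAl`) and this seat's
parts `ArrowBlockLipschitz` (p203102) / `ArrowOuterShiftBlocks` / `ArrowOuterShiftWeights`; no cited fact, no wall binder, no `def`, no unit sequence touched (ref2 c2/c3);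
every constant DISPLAYED and symbolic in `D`.  NOT summit progress; discharges nothing of the K-slot `GAN24.CombesThomas.ConvCK 3 Lc`: F6 is ONE of the four inputs
(F3 inner anchor, F4 inner Lipschitz, F5 outer anchor, F6 outer Lipschitz) of F7 = (U1) (leaf-09-g6 `FibreDetStripOfAnchors.outer_case`, hypothesis `hLip`).

## What is proved (every `D`, every `N ≥ 1`; `q ∈ [−π,π]^D ∖ {0}` the real anchor, `p` a strip point over it: `reVec p = q`, `|Im p_μ| ≤ η`, `0 ≤ η ≤ 1`;
`X := outerArrow N q`, `Y := X p − X (ofRealVec q)`; `w_i(m) = sinWt N (kfine N q m i)`, `K = 1 + √D·π/2`)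
* §1 radii: `radO N q 0 ≤ |q|₂ ≤ √D·π`, `2 ≤ radO N q m` (m ≠ 0), hence the ratio `r₀/r_m ≤ K` for every alias (`ratio_le`);
* §2 the four scaled border-weight differences alias by alias (prefactors `(N²/r_m²)(r₀²/N³)`, `(N³/r_m³)(r₀³/N³)`, `(r₀/N^{D+1})(N/r_m)`, `N^{−(D+1)}` — every
  `N`-power cancels EXACTLY): `‖Y.wE m κ‖ ≤ 7(D+1)η(r₀/r_m)²Π(8N√w_i)(8N√w_κ)/N^{D+1}`, `‖Y.wG m‖ ≤ 7Dη(r₀/r_m)³Π(8N√w_i)/N^D`, `‖Y.wM m‖ ≤ 7Dη(r₀/r_m)Π(8N√w_i)/N^D`,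
  `‖Y.wQ m κ‖ ≤ 7(D+1)ηΠ(8N√w_i)(8N√w_κ)/N^{D+1}`;
* §3 squares `≤ 49(D+1)²η²K⁶64^{D+1}·Πw_i·(w_κ)` and the alias sums (`ArrowOuterShiftWeights.sum_prod_sinWt_le`: `Σ_m Πw ≤ 5^D`) ⇒ the two border Frobenius bounds
  `‖colBorder (negLocW Y)‖, ‖rowBorder Y.borW‖ ≤ η·√(49(D+1)³K⁶64^{D+1}5^D)` (`norm_colBorder_sub_le`, `norm_rowBorder_sub_le`);
§4–§5 (blocks, assembly, the `hLip` form) are in `GAN24/ArrowOuterShift`.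
WHY THE CUBE (note to F7): the A–μ/G–A entries `L·∂` of the normalised zero-alias block are cubic in symbols each moving by `O(η/r₀)`, `r₀ ≍ |q|`, so the honest
modulus linear in `η` and uniform over `η ≤ 1` is `(1 + 1/|q|)³`; in F7's outer region `|q|∞ ≥ ρ₀/2` it is `≤ (1 + 2/ρ₀)³ =: Ω(ρ₀)` (`exists_radii` takes any `Ω`).
Unit `b2b-balaban-gan24-formalise-leaf-10` (G-an2-4 formalisation swarm, leaf prover 10, gen 5), 2026-08-20.  Value = one of F7's four inputs toward (I3′), NOT summit progress.
-/

noncomputable section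

open Complex Finset Matrix
open scoped BigOperators Real Matrix.Norms.L2Operator
open Literature.Probability.LatticeModels (TorusSite)
open Literature.MathematicalPhysics.QuantumFieldTheory.Balaban1983to89
open Literature.MathematicalPhysics.QuantumFieldTheory.Balaban1983to89.B4Strip (ofRealVec reVec Strip)
open Literature.MathematicalPhysics.QuantumFieldTheory.Balaban1983to89.B4ContourShift (BZ)
open Literature.MathematicalPhysics.QuantumFieldTheory.King1986 (momSq momSq_nonneg)

namespace Summit.QuantumFields.BalabanUV.Beta.GAN24.ArrowOuterShiftBorders

open ArrowOperator (Loc AIdx ArrowData arrowMat tBlock negLocW arrowMat_sub aliasArrow)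
open ArrowNorms (colBorder rowBorder norm_arrow_le norm_colBorder_le norm_rowBorder_le)
open ArrowScaling (radO sq_radO radO_pos scaledArrow outerArrow scaledArrow_T scaledArrow_wE scaledArrow_wG scaledArrow_wM scaledArrow_wQ arrowMat_eq_norms)
open AliasWeights (sinWt sinWt_pos sinWt_le_one kfine)
open AliasWeightsSum (lapR)
open AliasObjects (kAl sAl SAl sbAl SbAl chiAl dAl dbAl LAl)
open FibreArrow (chiHat sflat boxS boxSs)
open AliasFibreBridge (sflat_eq_sbAl boxS_eq_SAl chiHat_eq_chiAl boxSs_eq_SAl_mul_sAl)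
open ArrowOuterShiftBlocks (two_le_rad two_div_pi_mul_le_rad_zero)
open ArrowOuterShiftWeights (maj_nonneg norm_SAl_sub_le norm_SAl_sAl_sub_le norm_chiAl_sbAl_sub_le norm_chiAl_sub_le prod_maj_sq maj_sq
  prod_const_mul_sinWt sum_prod_sinWt_le sum_prod_sinWt_mul_le)

variable {D : ℕ} {N : ℕ} [NeZero N]

/-! ## §1 Radii: the ratio `r₀/r_m` is bounded by `K_D = 1 + √D·π/2` -/

/-- [folklore] `r₀ = radO N q 0 ≤ |q|₂` (`N²·lapR(q/N) ≤ |q|²`, leaf-12's `sq_mul_lapR_zero_le`). -/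
theorem radO_zero_le_sqrt (hN : 1 ≤ N) {q : Fin D → ℝ} (hq : ∀ i, |q i| ≤ π) (hq0 : q ≠ 0) :
    radO N q 0 ≤ Real.sqrt (momSq q) := by
  have h := CapacitanceScalarBounds.sq_mul_lapR_zero_le (D := D) hN q
  have h2 : radO N q 0 ^ 2 ≤ Real.sqrt (momSq q) ^ 2 := by rw [sq_radO, Real.sq_sqrt (momSq_nonneg q)]; exact h
  exact (pow_le_pow_iff_left₀ (radO_pos hq hq0 0).le (Real.sqrt_nonneg _) two_ne_zero).mp h2

/-- [folklore] `|q|₂ ≤ √D·π` on the Brillouin zone. -/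
theorem sqrt_momSq_le {q : Fin D → ℝ} (hq : ∀ i, |q i| ≤ π) : Real.sqrt (momSq q) ≤ Real.sqrt D * π := by
  have h : momSq q ≤ D * π ^ 2 := by
    unfold momSq
    calc ∑ i, q i ^ 2 ≤ ∑ _i : Fin D, π ^ 2 := Finset.sum_le_sum fun i _ => by
            rw [← sq_abs]; exact pow_le_pow_left₀ (abs_nonneg _) (hq i) 2
      _ = D * π ^ 2 := by rw [Finset.sum_const, Finset.card_univ, Fintype.card_fin, nsmul_eq_mul]
  calc Real.sqrt (momSq q) ≤ Real.sqrt (D * π ^ 2) := Real.sqrt_le_sqrt h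
    _ = Real.sqrt D * π := by rw [Real.sqrt_mul (Nat.cast_nonneg D), Real.sqrt_sq Real.pi_pos.le]

/-- [folklore] **RADIUS RATIO**: `r₀/r_m ≤ 1 + √D·π/2` for every alias (`m = 0`: ratio `1`; `m ≠ 0`: `r₀ ≤ √D·π`, `r_m ≥ 2`). -/
theorem ratio_le (hN : 1 ≤ N) {q : Fin D → ℝ} (hq : ∀ i, |q i| ≤ π) (hq0 : q ≠ 0) (m : TorusSite D N) :
    radO N q 0 / radO N q m ≤ 1 + Real.sqrt D * π / 2 := by
  have hK : 0 ≤ Real.sqrt D * π / 2 := by positivity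
  by_cases hm : m = 0
  · subst hm; rw [div_self (radO_pos hq hq0 (0 : TorusSite D N)).ne']; linarith
  · have h1 : radO N q 0 ≤ Real.sqrt D * π := (radO_zero_le_sqrt hN hq hq0).trans (sqrt_momSq_le hq)
    have h2 : 2 ≤ radO N q m := two_le_rad hq hm (radO_pos hq hq0 m) (sq_radO q m)
    rw [div_le_iff₀ (radO_pos hq hq0 m)]
    nlinarith [(radO_pos hq hq0 (0 : TorusSite D N)).le]

/-- [folklore] `0 ≤ r₀/r_m`. -/
theorem ratio_nonneg {q : Fin D → ℝ} (hq : ∀ i, |q i| ≤ π) (hq0 : q ≠ 0) (m : TorusSite D N) : 0 ≤ radO N q 0 / radO N q m :=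
  div_nonneg (radO_pos hq hq0 (0 : TorusSite D N)).le (radO_pos hq hq0 m).le

/-! ## §2 The four scaled border-weight differences, alias by alias -/

variable {q : Fin D → ℝ} {p : Fin D → ℂ} {η : ℝ}

/-- [folklore] Norm of a real-sandwiched difference: `‖↑a·x'·↑b − ↑a·x·↑b‖ = a·‖x' − x‖·b` for `a, b ≥ 0`. -/
theorem norm_sandwich_sub {a b : ℝ} (ha : 0 ≤ a) (hb : 0 ≤ b) (x x' : ℂ) :
    ‖(a : ℂ) * x' * (b : ℂ) - (a : ℂ) * x * (b : ℂ)‖ = a * ‖x' - x‖ * b := by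
  rw [show (a : ℂ) * x' * (b : ℂ) - (a : ℂ) * x * (b : ℂ) = (a : ℂ) * (x' - x) * (b : ℂ) by ring, norm_mul, norm_mul,
    Complex.norm_real, Complex.norm_real, Real.norm_eq_abs, Real.norm_eq_abs, abs_of_nonneg ha, abs_of_nonneg hb]

/-- [folklore] **EL–φ COLUMN**: `‖ΔwE_{mκ}‖ ≤ 7(D+1)η·(r₀/r_m)²·Π_i(8N√w_i)·(8N√w_κ)/N^{D+1}`. -/
theorem norm_wE_sub_le (hN : 1 ≤ N) (hq : ∀ i, |q i| ≤ π) (hq0 : q ≠ 0) (hpq : reVec p = q) (him : ∀ i, |(p i).im| ≤ η)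
    (hη0 : 0 ≤ η) (hη1 : η ≤ 1) (m : TorusSite D N) (κ : Fin D) :
    ‖(outerArrow N q p).wE m κ - (outerArrow N q (ofRealVec q)).wE m κ‖
      ≤ 7 * (D + 1) * η * (radO N q 0 / radO N q m) ^ 2 * (∏ i, (8 * (N : ℝ) * Real.sqrt (sinWt N (kfine N q m i))))
          * (8 * (N : ℝ) * Real.sqrt (sinWt N (kfine N q m κ))) / (N : ℝ) ^ (D + 1) := by
  have hN0 : (0 : ℝ) < N := by exact_mod_cast hN
  have hr := radO_pos hq hq0 m
  have hr0 := radO_pos hq hq0 (0 : TorusSite D N)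
  unfold outerArrow
  rw [scaledArrow_wE, scaledArrow_wE, chiHat_eq_chiAl, sflat_eq_sbAl, chiHat_eq_chiAl, sflat_eq_sbAl,
    norm_sandwich_sub (by positivity) (by positivity)]
  have hw := norm_chiAl_sbAl_sub_le hpq him hη0 hη1 m κ
  have hP : 0 ≤ 7 * (D + 1) * η * (∏ i, (8 * (N : ℝ) * Real.sqrt (sinWt N (kfine N q m i)))) * (8 * (N : ℝ) * Real.sqrt (sinWt N (kfine N q m κ)))
      / (N : ℝ) ^ D := by
    have := Finset.prod_nonneg fun i (_ : i ∈ Finset.univ) => maj_nonneg N (kfine N q m i)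
    positivity
  calc (N : ℝ) ^ 2 / radO N q m ^ 2 * ‖chiAl N p m * sbAl N p m κ - chiAl N (ofRealVec q) m * sbAl N (ofRealVec q) m κ‖ * (radO N q 0 ^ 2 / (N : ℝ) ^ 3)
      ≤ (N : ℝ) ^ 2 / radO N q m ^ 2 * (7 * (D + 1) * η * (∏ i, (8 * (N : ℝ) * Real.sqrt (sinWt N (kfine N q m i))))
          * (8 * (N : ℝ) * Real.sqrt (sinWt N (kfine N q m κ))) / (N : ℝ) ^ D) * (radO N q 0 ^ 2 / (N : ℝ) ^ 3) :=
        mul_le_mul_of_nonneg_right (mul_le_mul_of_nonneg_left hw (by positivity)) (by positivity)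
    _ = _ := by field_simp; ring

/-- [folklore] **G–c COLUMN**: `‖ΔwG_m‖ ≤ 7Dη·(r₀/r_m)³·Π_i(8N√w_i)/N^D`. -/
theorem norm_wG_sub_le (hN : 1 ≤ N) (hq : ∀ i, |q i| ≤ π) (hq0 : q ≠ 0) (hpq : reVec p = q) (him : ∀ i, |(p i).im| ≤ η)
    (hη0 : 0 ≤ η) (hη1 : η ≤ 1) (m : TorusSite D N) :
    ‖(outerArrow N q p).wG m - (outerArrow N q (ofRealVec q)).wG m‖
      ≤ 7 * D * η * (radO N q 0 / radO N q m) ^ 3 * (∏ i, (8 * (N : ℝ) * Real.sqrt (sinWt N (kfine N q m i)))) / (N : ℝ) ^ D := by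
  have hN0 : (0 : ℝ) < N := by exact_mod_cast hN
  have hr := radO_pos hq hq0 m
  have hr0 := radO_pos hq hq0 (0 : TorusSite D N)
  unfold outerArrow
  rw [scaledArrow_wG, scaledArrow_wG, chiHat_eq_chiAl, chiHat_eq_chiAl, norm_sandwich_sub (by positivity) (by positivity)]
  have hw := norm_chiAl_sub_le hpq him hη0 hη1 m
  have hP : 0 ≤ 7 * D * η * (∏ i, (8 * (N : ℝ) * Real.sqrt (sinWt N (kfine N q m i)))) / (N : ℝ) ^ D := by
    have := Finset.prod_nonneg fun i (_ : i ∈ Finset.univ) => maj_nonneg N (kfine N q m i)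
    positivity
  calc (N : ℝ) ^ 3 / radO N q m ^ 3 * ‖chiAl N p m - chiAl N (ofRealVec q) m‖ * (radO N q 0 ^ 3 / (N : ℝ) ^ 3)
      ≤ (N : ℝ) ^ 3 / radO N q m ^ 3 * (7 * D * η * (∏ i, (8 * (N : ℝ) * Real.sqrt (sinWt N (kfine N q m i)))) / (N : ℝ) ^ D)
          * (radO N q 0 ^ 3 / (N : ℝ) ^ 3) :=
        mul_le_mul_of_nonneg_right (mul_le_mul_of_nonneg_left hw (by positivity)) (by positivity)
    _ = _ := by field_simp

/-- [folklore] **M–μ ROW**: `‖ΔwM_m‖ ≤ 7Dη·(r₀/r_m)·Π_i(8N√w_i)/N^D`. -/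
theorem norm_wM_sub_le (hN : 1 ≤ N) (hq : ∀ i, |q i| ≤ π) (hq0 : q ≠ 0) (hpq : reVec p = q) (him : ∀ i, |(p i).im| ≤ η)
    (hη0 : 0 ≤ η) (hη1 : η ≤ 1) (m : TorusSite D N) :
    ‖(outerArrow N q p).wM m - (outerArrow N q (ofRealVec q)).wM m‖
      ≤ 7 * D * η * (radO N q 0 / radO N q m) * (∏ i, (8 * (N : ℝ) * Real.sqrt (sinWt N (kfine N q m i)))) / (N : ℝ) ^ D := by
  have hN0 : (0 : ℝ) < N := by exact_mod_cast hN
  have hr := radO_pos hq hq0 m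
  have hr0 := radO_pos hq hq0 (0 : TorusSite D N)
  unfold outerArrow
  rw [scaledArrow_wM, scaledArrow_wM, boxS_eq_SAl, boxS_eq_SAl, norm_sandwich_sub (by positivity) (by positivity)]
  have hw := norm_SAl_sub_le hpq him hη0 hη1 m
  calc radO N q 0 / (N : ℝ) ^ (D + 1) * ‖SAl N p m - SAl N (ofRealVec q) m‖ * ((N : ℝ) / radO N q m)
      ≤ radO N q 0 / (N : ℝ) ^ (D + 1) * (7 * D * η * ∏ i, (8 * (N : ℝ) * Real.sqrt (sinWt N (kfine N q m i)))) * ((N : ℝ) / radO N q m) :=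
        mul_le_mul_of_nonneg_right (mul_le_mul_of_nonneg_left hw (by positivity)) (by positivity)
    _ = _ := by field_simp; ring

/-- [folklore] **Q–A ROW**: `‖ΔwQ_{mκ}‖ ≤ 7(D+1)η·Π_i(8N√w_i)·(8N√w_κ)/N^{D+1}`. -/
theorem norm_wQ_sub_le (hN : 1 ≤ N) (hpq : reVec p = q) (him : ∀ i, |(p i).im| ≤ η) (hη0 : 0 ≤ η) (hη1 : η ≤ 1) (m : TorusSite D N) (κ : Fin D) :
    ‖(outerArrow N q p).wQ m κ - (outerArrow N q (ofRealVec q)).wQ m κ‖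
      ≤ 7 * (D + 1) * η * (∏ i, (8 * (N : ℝ) * Real.sqrt (sinWt N (kfine N q m i)))) * (8 * (N : ℝ) * Real.sqrt (sinWt N (kfine N q m κ)))
          / (N : ℝ) ^ (D + 1) := by
  have hN0 : (0 : ℝ) < N := by exact_mod_cast hN
  unfold outerArrow
  rw [scaledArrow_wQ, scaledArrow_wQ, boxSs_eq_SAl_mul_sAl, boxSs_eq_SAl_mul_sAl, norm_sandwich_sub (by positivity) zero_le_one]
  have hw := norm_SAl_sAl_sub_le hpq him hη0 hη1 m κ
  calc ((N : ℝ) ^ (D + 1))⁻¹ * ‖SAl N p m * sAl N p m κ - SAl N (ofRealVec q) m * sAl N (ofRealVec q) m κ‖ * 1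
      ≤ ((N : ℝ) ^ (D + 1))⁻¹ * (7 * (D + 1) * η * (∏ i, (8 * (N : ℝ) * Real.sqrt (sinWt N (kfine N q m i))))
          * (8 * (N : ℝ) * Real.sqrt (sinWt N (kfine N q m κ)))) * 1 :=
        mul_le_mul_of_nonneg_right (mul_le_mul_of_nonneg_left hw (by positivity)) zero_le_one
    _ = _ := by field_simp


/-! ## §3 Squares, the uniform constant, and the two border Frobenius sums -/

/-- [folklore] Real helper: `0 ≤ a ≤ B`, `B² = c·ρ·X`, `ρ ≤ K`, `c, X ≥ 0` ⇒ `a² ≤ c·K·X`. -/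
theorem sq_le_of_le_of_sq_eq {a B c ρ K X : ℝ} (ha : 0 ≤ a) (h : a ≤ B) (hB : B ^ 2 = c * ρ * X) (hρ : ρ ≤ K) (hc : 0 ≤ c) (hX : 0 ≤ X) :
    a ^ 2 ≤ c * K * X :=
  calc a ^ 2 ≤ B ^ 2 := pow_le_pow_left₀ ha h 2
    _ = c * ρ * X := hB
    _ ≤ c * K * X := mul_le_mul_of_nonneg_right (mul_le_mul_of_nonneg_left hρ hc) hX

/-- [folklore] Powers of the radius ratio against `K⁶`, `K = 1 + √D·π/2 ≥ 1`: `ρ^j ≤ K⁶` for `j ≤ 6` (here `j = 2, 4, 6`) and `1 ≤ K⁶`. -/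
theorem ratio_pow_le (hN : 1 ≤ N) (hq : ∀ i, |q i| ≤ π) (hq0 : q ≠ 0) (m : TorusSite D N) {j : ℕ} (hj : j ≤ 6) :
    (radO N q 0 / radO N q m) ^ j ≤ (1 + Real.sqrt D * π / 2) ^ 6 := by
  have h1 : 1 ≤ 1 + Real.sqrt D * π / 2 := by linarith [show (0 : ℝ) ≤ Real.sqrt D * π / 2 by positivity]
  calc (radO N q 0 / radO N q m) ^ j ≤ (1 + Real.sqrt D * π / 2) ^ j :=
        pow_le_pow_left₀ (ratio_nonneg hq hq0 m) (ratio_le hN hq hq0 m) j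
    _ ≤ (1 + Real.sqrt D * π / 2) ^ 6 := pow_le_pow_right₀ h1 hj

/-- [folklore] **EL–φ COLUMN, SQUARED**: `‖ΔwE_{mκ}‖² ≤ 49(D+1)²η²·K⁶·64^{D+1}·(Π_i w_i)·w_κ`. -/
theorem sq_wE_sub_le (hN : 1 ≤ N) (hq : ∀ i, |q i| ≤ π) (hq0 : q ≠ 0) (hpq : reVec p = q) (him : ∀ i, |(p i).im| ≤ η)
    (hη0 : 0 ≤ η) (hη1 : η ≤ 1) (m : TorusSite D N) (κ : Fin D) :
    ‖(outerArrow N q p).wE m κ - (outerArrow N q (ofRealVec q)).wE m κ‖ ^ 2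
      ≤ (49 * (D + 1) ^ 2 * η ^ 2 * (64 : ℝ) ^ (D + 1)) * (1 + Real.sqrt D * π / 2) ^ 6
          * ((∏ i, sinWt N (kfine N q m i)) * sinWt N (kfine N q m κ)) := by
  have hN0 : (0 : ℝ) < N := by exact_mod_cast hN
  refine sq_le_of_le_of_sq_eq (norm_nonneg _) (norm_wE_sub_le hN hq hq0 hpq him hη0 hη1 m κ) ?_ (ratio_pow_le hN hq hq0 m (by norm_num : 4 ≤ 6))
    (by positivity) (mul_nonneg (Finset.prod_nonneg fun i _ => (sinWt_pos _ _).le) (sinWt_pos _ _).le)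
  rw [div_pow, show ∀ a b c d e : ℝ, (a * b * c * d * e) ^ 2 = a ^ 2 * b ^ 2 * c ^ 2 * d ^ 2 * e ^ 2 from fun a b c d e => by ring,
    prod_maj_sq, prod_const_mul_sinWt, maj_sq]
  field_simp
  ring

/-- [folklore] **G–c COLUMN, SQUARED**: `‖ΔwG_m‖² ≤ 49(D+1)²η²·K⁶·64^{D+1}·Π_i w_i`. -/
theorem sq_wG_sub_le (hN : 1 ≤ N) (hq : ∀ i, |q i| ≤ π) (hq0 : q ≠ 0) (hpq : reVec p = q) (him : ∀ i, |(p i).im| ≤ η)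
    (hη0 : 0 ≤ η) (hη1 : η ≤ 1) (m : TorusSite D N) :
    ‖(outerArrow N q p).wG m - (outerArrow N q (ofRealVec q)).wG m‖ ^ 2
      ≤ (49 * (D + 1) ^ 2 * η ^ 2 * (64 : ℝ) ^ (D + 1)) * (1 + Real.sqrt D * π / 2) ^ 6 * ∏ i, sinWt N (kfine N q m i) := by
  have hN0 : (0 : ℝ) < N := by exact_mod_cast hN
  have hP : 0 ≤ ∏ i, sinWt N (kfine N q m i) := Finset.prod_nonneg fun i _ => (sinWt_pos _ _).le
  have h1 : ‖(outerArrow N q p).wG m - (outerArrow N q (ofRealVec q)).wG m‖ ^ 2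
      ≤ (49 * D ^ 2 * η ^ 2 * (64 : ℝ) ^ D) * (1 + Real.sqrt D * π / 2) ^ 6 * ∏ i, sinWt N (kfine N q m i) := by
    refine sq_le_of_le_of_sq_eq (norm_nonneg _) (norm_wG_sub_le hN hq hq0 hpq him hη0 hη1 m) ?_ (ratio_pow_le hN hq hq0 m le_rfl)
      (by positivity) hP
    rw [div_pow, show ∀ a b c d e : ℝ, (a * b * c * d * e) ^ 2 = a ^ 2 * b ^ 2 * c ^ 2 * d ^ 2 * e ^ 2 from fun a b c d e => by ring,
      prod_maj_sq, prod_const_mul_sinWt]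
    field_simp
    ring
  refine h1.trans (mul_le_mul_of_nonneg_right (mul_le_mul_of_nonneg_right ?_ (by positivity)) hP)
  have hD : (0 : ℝ) ≤ D := Nat.cast_nonneg D
  have h64 : (64 : ℝ) ^ D ≤ 64 ^ (D + 1) := pow_le_pow_right₀ (by norm_num) (Nat.le_succ D)
  have hDD : (D : ℝ) ^ 2 ≤ (D + 1) ^ 2 := by nlinarith
  have := mul_le_mul hDD h64 (by positivity) (by positivity)
  nlinarith [sq_nonneg η]

/-- [folklore] **M–μ ROW, SQUARED**: `‖ΔwM_m‖² ≤ 49(D+1)²η²·K⁶·64^{D+1}·Π_i w_i`. -/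
theorem sq_wM_sub_le (hN : 1 ≤ N) (hq : ∀ i, |q i| ≤ π) (hq0 : q ≠ 0) (hpq : reVec p = q) (him : ∀ i, |(p i).im| ≤ η)
    (hη0 : 0 ≤ η) (hη1 : η ≤ 1) (m : TorusSite D N) :
    ‖(outerArrow N q p).wM m - (outerArrow N q (ofRealVec q)).wM m‖ ^ 2
      ≤ (49 * (D + 1) ^ 2 * η ^ 2 * (64 : ℝ) ^ (D + 1)) * (1 + Real.sqrt D * π / 2) ^ 6 * ∏ i, sinWt N (kfine N q m i) := by
  have hN0 : (0 : ℝ) < N := by exact_mod_cast hN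
  have hP : 0 ≤ ∏ i, sinWt N (kfine N q m i) := Finset.prod_nonneg fun i _ => (sinWt_pos _ _).le
  have h1 : ‖(outerArrow N q p).wM m - (outerArrow N q (ofRealVec q)).wM m‖ ^ 2
      ≤ (49 * D ^ 2 * η ^ 2 * (64 : ℝ) ^ D) * (1 + Real.sqrt D * π / 2) ^ 6 * ∏ i, sinWt N (kfine N q m i) := by
    refine sq_le_of_le_of_sq_eq (norm_nonneg _) (norm_wM_sub_le hN hq hq0 hpq him hη0 hη1 m) ?_ (ratio_pow_le hN hq hq0 m (by norm_num : 2 ≤ 6))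
      (by positivity) hP
    rw [div_pow, show ∀ a b c d e : ℝ, (a * b * c * d * e) ^ 2 = a ^ 2 * b ^ 2 * c ^ 2 * d ^ 2 * e ^ 2 from fun a b c d e => by ring,
      prod_maj_sq, prod_const_mul_sinWt]
    field_simp
    ring
  refine h1.trans (mul_le_mul_of_nonneg_right (mul_le_mul_of_nonneg_right ?_ (by positivity)) hP)
  have hD : (0 : ℝ) ≤ D := Nat.cast_nonneg D
  have h64 : (64 : ℝ) ^ D ≤ 64 ^ (D + 1) := pow_le_pow_right₀ (by norm_num) (Nat.le_succ D)
  have hDD : (D : ℝ) ^ 2 ≤ (D + 1) ^ 2 := by nlinarith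
  have := mul_le_mul hDD h64 (by positivity) (by positivity)
  nlinarith [sq_nonneg η]

/-- [folklore] **Q–A ROW, SQUARED**: `‖ΔwQ_{mκ}‖² ≤ 49(D+1)²η²·K⁶·64^{D+1}·(Π_i w_i)·w_κ`. -/
theorem sq_wQ_sub_le (hN : 1 ≤ N) (hpq : reVec p = q) (him : ∀ i, |(p i).im| ≤ η) (hη0 : 0 ≤ η) (hη1 : η ≤ 1)
    (m : TorusSite D N) (κ : Fin D) :
    ‖(outerArrow N q p).wQ m κ - (outerArrow N q (ofRealVec q)).wQ m κ‖ ^ 2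
      ≤ (49 * (D + 1) ^ 2 * η ^ 2 * (64 : ℝ) ^ (D + 1)) * (1 + Real.sqrt D * π / 2) ^ 6
          * ((∏ i, sinWt N (kfine N q m i)) * sinWt N (kfine N q m κ)) := by
  have hN0 : (0 : ℝ) < N := by exact_mod_cast hN
  have h1 : 1 ≤ (1 + Real.sqrt D * π / 2) ^ 6 := one_le_pow₀ (by linarith [show (0 : ℝ) ≤ Real.sqrt D * π / 2 by positivity])
  refine sq_le_of_le_of_sq_eq (ρ := 1) (norm_nonneg _) (norm_wQ_sub_le hN hpq him hη0 hη1 m κ) ?_ h1 (by positivity)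
    (mul_nonneg (Finset.prod_nonneg fun i _ => (sinWt_pos _ _).le) (sinWt_pos _ _).le)
  rw [div_pow, show ∀ a b c d : ℝ, (a * b * c * d) ^ 2 = a ^ 2 * b ^ 2 * c ^ 2 * d ^ 2 from fun a b c d => by ring,
    prod_maj_sq, prod_const_mul_sinWt, maj_sq]
  field_simp
  ring

/-- [folklore] The two alias sums of the weight products, combined: `Σ_m Π_i w_i·(Σ_κ w_κ + 1) ≤ (D+1)·5^D`. -/
theorem sum_prod_sum_le (hq : ∀ i, |q i| ≤ π) :
    ∑ m : TorusSite D N, ((∑ κ, (∏ i, sinWt N (kfine N q m i)) * sinWt N (kfine N q m κ)) + ∏ i, sinWt N (kfine N q m i))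
      ≤ (D + 1) * (5 : ℝ) ^ D := by
  rw [Finset.sum_add_distrib, Finset.sum_comm]
  have h1 : ∑ κ : Fin D, ∑ m : TorusSite D N, (∏ i, sinWt N (kfine N q m i)) * sinWt N (kfine N q m κ) ≤ D * (5 : ℝ) ^ D := by
    calc ∑ κ : Fin D, ∑ m : TorusSite D N, (∏ i, sinWt N (kfine N q m i)) * sinWt N (kfine N q m κ)
        ≤ ∑ _κ : Fin D, (5 : ℝ) ^ D := Finset.sum_le_sum fun κ _ => sum_prod_sinWt_mul_le hq κ
      _ = D * (5 : ℝ) ^ D := by rw [Finset.sum_const, Finset.card_univ, Fintype.card_fin, nsmul_eq_mul]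
  have h2 := sum_prod_sinWt_le (N := N) hq
  linarith

/-- [folklore] **THE COLUMN BORDER** of the difference: `‖colBorder (negLocW (X' − X))‖ ≤ η·√(49(D+1)³·K⁶·64^{D+1}·5^D)` (F1b `norm_colBorder_le`). -/
theorem norm_colBorder_sub_le (hN : 1 ≤ N) (hq : ∀ i, |q i| ≤ π) (hq0 : q ≠ 0) (hpq : reVec p = q) (him : ∀ i, |(p i).im| ≤ η)
    (hη0 : 0 ≤ η) (hη1 : η ≤ 1) :
    ‖colBorder (negLocW (outerArrow N q p - outerArrow N q (ofRealVec q)))‖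
      ≤ η * Real.sqrt (49 * (D + 1) ^ 3 * (1 + Real.sqrt D * π / 2) ^ 6 * (64 : ℝ) ^ (D + 1) * (5 : ℝ) ^ D) := by
  set C₂ : ℝ := (49 * (D + 1) ^ 2 * η ^ 2 * (64 : ℝ) ^ (D + 1)) * (1 + Real.sqrt D * π / 2) ^ 6 with hC₂
  have hC₂0 : 0 ≤ C₂ := by positivity
  refine (norm_colBorder_le _).trans ?_
  have hsum : ∑ m, ∑ s, ‖negLocW (outerArrow N q p - outerArrow N q (ofRealVec q)) m s‖ ^ 2
      ≤ C₂ * ((D + 1) * (5 : ℝ) ^ D) := by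
    calc ∑ m, ∑ s, ‖negLocW (outerArrow N q p - outerArrow N q (ofRealVec q)) m s‖ ^ 2
        = ∑ m, ((∑ κ, ‖(outerArrow N q p).wE m κ - (outerArrow N q (ofRealVec q)).wE m κ‖ ^ 2)
            + ‖(outerArrow N q p).wG m - (outerArrow N q (ofRealVec q)).wG m‖ ^ 2) := by
          refine Finset.sum_congr rfl fun m _ => ?_
          simp only [Fintype.sum_sum_type, Fintype.sum_unique, negLocW, ArrowData.locW, Sum.elim_inl, Sum.elim_inr, norm_neg,
            ArrowData.sub_wE, ArrowData.sub_wG, Pi.sub_apply]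
      _ ≤ ∑ m, ((∑ κ, C₂ * ((∏ i, sinWt N (kfine N q m i)) * sinWt N (kfine N q m κ))) + C₂ * ∏ i, sinWt N (kfine N q m i)) :=
          Finset.sum_le_sum fun m _ => add_le_add (Finset.sum_le_sum fun κ _ => sq_wE_sub_le hN hq hq0 hpq him hη0 hη1 m κ)
            (sq_wG_sub_le hN hq hq0 hpq him hη0 hη1 m)
      _ = C₂ * ∑ m, ((∑ κ, (∏ i, sinWt N (kfine N q m i)) * sinWt N (kfine N q m κ)) + ∏ i, sinWt N (kfine N q m i)) := by
          rw [Finset.mul_sum]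
          refine Finset.sum_congr rfl fun m _ => ?_
          rw [mul_add, Finset.mul_sum]
      _ ≤ C₂ * ((D + 1) * (5 : ℝ) ^ D) := mul_le_mul_of_nonneg_left (sum_prod_sum_le hq) hC₂0
  calc Real.sqrt (∑ m, ∑ s, ‖negLocW (outerArrow N q p - outerArrow N q (ofRealVec q)) m s‖ ^ 2)
      ≤ Real.sqrt (C₂ * ((D + 1) * (5 : ℝ) ^ D)) := Real.sqrt_le_sqrt hsum
    _ = η * Real.sqrt (49 * (D + 1) ^ 3 * (1 + Real.sqrt D * π / 2) ^ 6 * (64 : ℝ) ^ (D + 1) * (5 : ℝ) ^ D) := by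
        rw [hC₂, show (49 * ((D : ℝ) + 1) ^ 2 * η ^ 2 * 64 ^ (D + 1)) * (1 + Real.sqrt D * π / 2) ^ 6 * ((D + 1) * 5 ^ D)
            = η ^ 2 * (49 * (D + 1) ^ 3 * (1 + Real.sqrt D * π / 2) ^ 6 * 64 ^ (D + 1) * 5 ^ D) by ring,
          Real.sqrt_mul (sq_nonneg η), Real.sqrt_sq hη0]

/-- [folklore] **THE ROW BORDER** of the difference: `‖rowBorder (X' − X).borW‖ ≤ η·√(49(D+1)³·K⁶·64^{D+1}·5^D)` (F1b `norm_rowBorder_le`). -/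
theorem norm_rowBorder_sub_le (hN : 1 ≤ N) (hq : ∀ i, |q i| ≤ π) (hq0 : q ≠ 0) (hpq : reVec p = q) (him : ∀ i, |(p i).im| ≤ η)
    (hη0 : 0 ≤ η) (hη1 : η ≤ 1) :
    ‖rowBorder (outerArrow N q p - outerArrow N q (ofRealVec q)).borW‖
      ≤ η * Real.sqrt (49 * (D + 1) ^ 3 * (1 + Real.sqrt D * π / 2) ^ 6 * (64 : ℝ) ^ (D + 1) * (5 : ℝ) ^ D) := by
  set C₂ : ℝ := (49 * (D + 1) ^ 2 * η ^ 2 * (64 : ℝ) ^ (D + 1)) * (1 + Real.sqrt D * π / 2) ^ 6 with hC₂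
  have hC₂0 : 0 ≤ C₂ := by positivity
  refine (norm_rowBorder_le _).trans ?_
  have hsum : ∑ m, ∑ s, ‖(outerArrow N q p - outerArrow N q (ofRealVec q)).borW m s‖ ^ 2 ≤ C₂ * ((D + 1) * (5 : ℝ) ^ D) := by
    calc ∑ m, ∑ s, ‖(outerArrow N q p - outerArrow N q (ofRealVec q)).borW m s‖ ^ 2
        = ∑ m, ((∑ κ, ‖(outerArrow N q p).wQ m κ - (outerArrow N q (ofRealVec q)).wQ m κ‖ ^ 2)
            + ‖(outerArrow N q p).wM m - (outerArrow N q (ofRealVec q)).wM m‖ ^ 2) := by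
          refine Finset.sum_congr rfl fun m _ => ?_
          simp only [Fintype.sum_sum_type, Fintype.sum_unique, ArrowData.borW, Sum.elim_inl, Sum.elim_inr, ArrowData.sub_wQ,
            ArrowData.sub_wM, Pi.sub_apply]
      _ ≤ ∑ m, ((∑ κ, C₂ * ((∏ i, sinWt N (kfine N q m i)) * sinWt N (kfine N q m κ))) + C₂ * ∏ i, sinWt N (kfine N q m i)) :=
          Finset.sum_le_sum fun m _ => add_le_add (Finset.sum_le_sum fun κ _ => sq_wQ_sub_le hN hpq him hη0 hη1 m κ)
            (sq_wM_sub_le hN hq hq0 hpq him hη0 hη1 m)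
      _ = C₂ * ∑ m, ((∑ κ, (∏ i, sinWt N (kfine N q m i)) * sinWt N (kfine N q m κ)) + ∏ i, sinWt N (kfine N q m i)) := by
          rw [Finset.mul_sum]
          refine Finset.sum_congr rfl fun m _ => ?_
          rw [mul_add, Finset.mul_sum]
      _ ≤ C₂ * ((D + 1) * (5 : ℝ) ^ D) := mul_le_mul_of_nonneg_left (sum_prod_sum_le hq) hC₂0
  calc Real.sqrt (∑ m, ∑ s, ‖(outerArrow N q p - outerArrow N q (ofRealVec q)).borW m s‖ ^ 2)
      ≤ Real.sqrt (C₂ * ((D + 1) * (5 : ℝ) ^ D)) := Real.sqrt_le_sqrt hsum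
    _ = η * Real.sqrt (49 * (D + 1) ^ 3 * (1 + Real.sqrt D * π / 2) ^ 6 * (64 : ℝ) ^ (D + 1) * (5 : ℝ) ^ D) := by
        rw [hC₂, show (49 * ((D : ℝ) + 1) ^ 2 * η ^ 2 * 64 ^ (D + 1)) * (1 + Real.sqrt D * π / 2) ^ 6 * ((D + 1) * 5 ^ D)
            = η ^ 2 * (49 * (D + 1) ^ 3 * (1 + Real.sqrt D * π / 2) ^ 6 * 64 ^ (D + 1) * 5 ^ D) by ring,
          Real.sqrt_mul (sq_nonneg η), Real.sqrt_sq hη0]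

end Summit.QuantumFields.BalabanUV.Beta.GAN24.ArrowOuterShiftBorders

end
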